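import Literature.MathematicalPhysics.QuantumLattice.HubbardTTPrimeOpenBoxGrandCanonicalPressureBound
import Literature.MathematicalPhysics.QuantumLattice.HubbardTTPrimeGrandCanonicalThermalStatesEntropyRow
import Literature.MathematicalPhysics.QuantumLattice.InfVolFermionStateTTPrimeMeanEnergyBox
import Literature.MathematicalPhysics.QuantumLattice.HubbardEnergyDensityVariationalPrinciple
import Literature.MathematicalPhysics.QuantumLattice.GibbsVariationalPrincipleWitness
import HarnessLib

/-!
# The entropy density of the thermal grand-canonical states of the 2D `t–t'` Hubbard model exists and equals
# `P + β u`; every translation-invariant state has box entropies `≤ |B|(P + βu) + o(|B|)` (Gibbs' variational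
# principle in the thermodynamic limit, upper half + attainment)

Topic `Literature/MathematicalPhysics/QuantumLattice`. Notation: `P = gcPressureTT'Zeeman β t t' U μ h` (the
grand-canonical pressure, `…GrandCanonicalPressureZeeman`), `B_ℓ = [0,ℓ)² ⊂ ℤ²` (`halfOpenBox 2 ℓ`),
`K_{B_ℓ} = gcLocalHamiltonianTT' B_ℓ t t' U μ h = H^{tt'}_{B_ℓ} − μN − hM` (free boundary conditions), `ω_B = ω.rdm B`
the density matrix of the restriction of an infinite-volume state `ω` to `𝔄_B`, `S` the von Neumann entropy, and
for a translation-invariant `ω`: `u(ω) = e_{Φ(t,t',U)}(ω) − μρ(ω) − h m(ω)` (the `K`-energy per site; `m = Re ω(n_{0↑}) −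
Re ω(n_{0↓})`). PROVED:

* (§1 = `GibbsVariationalPrincipleWitness.lean`: `S(ρ) = inf_G [Re tr(ρG) + log Tr e^{−G}]` over Hermitian witnesses —
  `Matrix.le_vonNeumannEntropy_of_forall_witness`, used in §4.)
* §2 `IsTranslationInvariant.re_expect_spinImbalance` (`Re ω(M_B) = |B|·m(ω)`) and
  `IsTranslationInvariant.re_expect_gcLocalHamiltonianTT'_halfOpenBox_le`:
  `Re ω(K_{B_ℓ}) ≤ ℓ² u(ω) + (8|t|+16|t'|)ℓ`.
* §3 **UPPER HALF OF THE VARIATIONAL PRINCIPLE, every `ℓ ≥ 1`, every translation-invariant state**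
  (`IsTranslationInvariant.vonNeumannEntropy_rdm_halfOpenBox_le`, `β ≥ 0`, `U ≥ 0`):
  `S(ω_{B_ℓ}) ≤ ℓ²·(P + β u(ω)) + β(8|t|+16|t'|)ℓ + 2 log(ℓ²+1)`
  (Gibbs' inequality for `ω_{B_ℓ}` against `K_{B_ℓ}` + `log Re Tr e^{−βK_{B_ℓ}} ≤ ℓ²P + 2log(ℓ²+1)` of
  `HubbardTTPrimeOpenBoxGrandCanonicalPressureBound`); per site with rate `(β(8|t|+16|t'|) + 4)/ℓ`
  (`…_div_sq_le`), hence `∀ ε > 0, ∀ᶠ ℓ, S(ω_{B_ℓ})/ℓ² ≤ P + βu(ω) + ε` (`…eventually_le`).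
* §4 **THERMAL GRAND-CANONICAL STATES ATTAIN IT**: for a torus limit `ω` of the grand-canonical Gibbs states
  (`IsTorusLimitOfMixture sourcedGibbsCount (gcGibbsWeightTT' …) (gcGibbsVectorTT' …) Ls`, `Ls → ∞`):
  `ℓ²·(P + βu(ω)) ≤ S(ω_{B_ℓ})` for EVERY `ℓ ≥ 1` (`…le_vonNeumannEntropy_rdm_halfOpenBox_of_gcGibbs`; the entropy row of
  `…ThermalStatesEntropyRow` + the witness lemma), the two-sided finite-box window
  `P + βu(ω) ≤ S(ω_{B_ℓ})/ℓ² ≤ P + βu(ω) + (β(8|t|+16|t'|)+4)/ℓ` (`…mem_Icc_of_gcGibbs`), and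
  **`S(ω_{B_ℓ})/ℓ² → P + β u(ω)`** (`…tendsto_vonNeumannEntropy_rdm_div_sq_of_gcGibbs`): THE ENTROPY DENSITY OF A
  THERMAL GRAND-CANONICAL STATE EXISTS AND EQUALS `P + βu(ω)`; consequently (`…variational_principle_of_gcGibbs`)
  for every translation-invariant `ω'`: `∀ ε > 0, ∀ᶠ ℓ, S(ω'_{B_ℓ})/ℓ² − βu(ω') ≤ S(ω_{B_ℓ})/ℓ² − βu(ω) + ε` —
  thermal states maximise «entropy minus `β`·energy» per site among translation-invariant states, the maximum
  being the pressure.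

USE: (i) `s(ω) = P + βu(ω)` makes the ENTROPY PER SITE of a thermal state a certified number from a pressure
window and a `K`-energy window (R59/R67 of the cell's recipes): `W ≤ P ≤ Q`, `u(ω) ∈ [u₋,u₊]` ⇒
`s ∈ [W + βu₋, Q + βu₊]`; (ii) every translation-invariant trial state with a computable box-entropy asymptotics
gives a PRESSURE FLOOR `P ≥ limsup S(ω'_{B_ℓ})/ℓ² − βu(ω')` (the thermodynamic-limit Gibbs–Bogoliubov / cluster
bounds). No mean-entropy object is DEFINED here (statements are about `S(ω.rdm (halfOpenBox 2 ℓ))`); everything is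
PROVED; no named fact.

## Mathlib / tree search

REUSED: `log_partitionFn_gcLocalHamiltonianTT'_halfOpenBox_le`, `gcLocalHamiltonianTT'_isHermitian`
(`HubbardTTPrimeOpenBoxGrandCanonicalPressureBound`); `Matrix.le_vonNeumannEntropy_of_forall_witness` (`GibbsVariationalPrincipleWitness`); `IsTorusLimitOfMixture.gcPressureTT'Zeeman_add_mul_energy_le_of_gcGibbs_box`
(`…ThermalStatesEntropyRow`); `Matrix.IsHermitian.vonNeumannEntropy_sub_mul_le_log_partitionFn` (`GibbsVariationalPrinciple`);
`rdm`, `trace_rdm_mul`,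
`trace_rdm`, `rdm_posSemidef` (`InfVolFermionState`); `IsTranslationInvariant.abs_sq_mul_meanEnergyTTPrime_sub_re_expect_localHamiltonian_le`
(`InfVolFermionStateTTPrimeMeanEnergyBox`); `IsTranslationInvariant.re_expect_totalNumber`, `….expect_nAt`
(`HubbardEnergyDensityVariationalPrinciple`); `vonNeumannEntropy_eq`, `sum_eigenvalues_eq_one` (`InformationTheory/Entropy`);
Mathlib `Real.log_le_sub_one_of_pos`, `tendsto_const_div_atTop_nhds_zero_nat`, `tendsto_of_tendsto_of_tendsto_of_le_of_le'`.
`lean search 'entropy density|meanEntropy|vonNeumannEntropy_rdm'`: nothing (2026-08-27) — the tree had the finite-volume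
principle and the entropy ROW (a lower bound in witness form), not the upper half nor the limit.

## References

* H. Araki, H. Moriya, Rev. Math. Phys. 15 (2003) 93, Thm. 3.8, §10–§11 (mean entropy and the variational principle for
  lattice fermion systems). [cite: ArakiMoriya2003, Theorem 3.8 and §10]
* R. B. Israel, *Convexity in the Theory of Lattice Gases* (1979), Lemma II.3.1, Thm. II.3.2 (finite-volume principle;
  `P = sup_ω [s(ω) − βu(ω)]`). [cite: Israel1979, Lemma II.3.1]
* O. Bratteli, D. W. Robinson, *OAQSM 2* (1997), Thm. 6.2.40 (mean entropy, variational principle, quantum spin systems).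
  [cite: BratteliRobinsonII1997, Thm. 6.2.40]
* M. A. Nielsen, I. L. Chuang, *Quantum Computation and Quantum Information* (2010), §11.3 eq. (11.40). [cite: NielsenChuang2010, §11.3 eq. (11.40)]
-/

noncomputable section

open scoped ComplexOrder BigOperators
open Finset Literature.InformationTheory.Entropy



namespace Literature.MathematicalPhysics.QuantumLattice

open Matrix HubbardWave0 Literature.Probability.LatticeModels ThermodynamicLimit
open _root_.Filter
open scoped _root_.Topology

namespace InfVolFermionState

variable {ω : InfVolFermionState 2}

/-! ### §2 The `K`-energy of a box in a translation-invariant state -/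

/-- **The expected spin imbalance of a region is `|Λ| × m(ω)`** for translation-invariant `ω`:
`Re ω(M_Λ) = |Λ|·(Re ω(n_{0↑}) − Re ω(n_{0↓}))`. [cite: BratteliRobinsonII1997, §6.2.4] -/
theorem IsTranslationInvariant.re_expect_spinImbalance (hω : ω.IsTranslationInvariant) (Λ : Finset (Site 2)) :
    (ω.expect Λ (spinImbalance : FermionOp Λ)).re =
      Λ.card * ((ω.expect ({0} : Finset (Site 2)) (nAt 0 (mem_singleton_self 0) 0)).re -
        (ω.expect ({0} : Finset (Site 2)) (nAt 0 (mem_singleton_self 0) 1)).re) := by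
  let e : PolySite Λ ≃ {x // x ∈ Λ} :=
    ⟨fun a => ⟨ofLex a.1, PolySite.ofLex_mem a⟩, fun x => PolySite.pt x.1 x.2, fun a => PolySite.pt_ofLex a,
      fun x => Subtype.ext rfl⟩
  have hsum : (spinImbalance : FermionOp Λ) =
      ∑ x ∈ Λ.attach, (numberOp (PolySite.pt x.1 x.2) 0 - numberOp (PolySite.pt x.1 x.2) 1) := by
    rw [spinImbalance, ← Finset.univ_eq_attach]
    refine Fintype.sum_equiv e _ _ fun a => ?_
    rw [show PolySite.pt (e a).1 (e a).2 = e.symm (e a) from rfl, Equiv.symm_apply_apply]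
  have hterm : ∀ x : {x // x ∈ Λ},
      (ω.expect Λ (numberOp (PolySite.pt x.1 x.2) 0 - numberOp (PolySite.pt x.1 x.2) 1)).re =
        (ω.expect ({0} : Finset (Site 2)) (nAt 0 (mem_singleton_self 0) 0)).re -
          (ω.expect ({0} : Finset (Site 2)) (nAt 0 (mem_singleton_self 0) 1)).re := by
    intro x
    have hcomp : ∀ σ : Fin 2, ω.expect Λ (numberOp (PolySite.pt x.1 x.2) σ) =
        ω.expect {x.1} (nAt x.1 (mem_singleton_self x.1) σ) := by
      intro σ
      rw [← ω.compatible (singleton_subset_iff.2 x.2) (nAt x.1 (mem_singleton_self x.1) σ), nAt,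
        fermionEmbed_numberOp, PolySite.incl_pt]
    rw [map_sub, hcomp, hcomp, hω.expect_nAt x.1 0, hω.expect_nAt x.1 1, Complex.sub_re]
  rw [hsum, map_sum, Complex.re_sum, Finset.sum_congr rfl fun x _ => hterm x, sum_const, card_attach, nsmul_eq_mul]

/-- **The `K`-energy of the box `[0,ℓ)²` in a translation-invariant state is at most `ℓ² u(ω) + (8|t|+16|t'|)ℓ`**:
`Re ω(K_{B_ℓ}) ≤ ℓ²·(e_Φ(ω) − μρ(ω) − h m(ω)) + (8|t|+16|t'|)ℓ` (the on-site parts are exact, the hopping part loses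
at most the boundary bonds). [cite: BratteliRobinsonII1997, §6.2.4] -/
theorem IsTranslationInvariant.re_expect_gcLocalHamiltonianTT'_halfOpenBox_le (hω : ω.IsTranslationInvariant)
    (t t' U μ hz : ℝ) (ℓ : ℕ) :
    (ω.expect (halfOpenBox 2 ℓ) (gcLocalHamiltonianTT' (halfOpenBox 2 ℓ) t t' U μ hz)).re ≤
      (ℓ : ℝ) ^ 2 * (ω.meanEnergy (hubbardTTPrimeFermionInteraction t t' U) 1 - μ * ω.density -
        hz * ((ω.expect ({0} : Finset (Site 2)) (nAt 0 (mem_singleton_self 0) 0)).re -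
          (ω.expect ({0} : Finset (Site 2)) (nAt 0 (mem_singleton_self 0) 1)).re)) +
        (8 * |t| + 16 * |t'|) * ℓ := by
  have hH := hω.abs_sq_mul_meanEnergyTTPrime_sub_re_expect_localHamiltonian_le t' t U ℓ
  have hN := hω.re_expect_totalNumber (halfOpenBox 2 ℓ)
  have hM := hω.re_expect_spinImbalance (halfOpenBox 2 ℓ)
  have hcard : ((halfOpenBox 2 ℓ).card : ℝ) = (ℓ : ℝ) ^ 2 := by rw [card_halfOpenBox]; push_cast; ring
  rw [hcard] at hN hM
  rw [gcLocalHamiltonianTT'_eq, map_sub, map_sub, map_smul, map_smul, Complex.sub_re, Complex.sub_re, smul_eq_mul,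
    smul_eq_mul, Complex.re_ofReal_mul, Complex.re_ofReal_mul, hN, hM]
  rw [abs_le] at hH
  nlinarith [hH.1, hH.2]

/-! ### §3 The upper half of the variational principle: every translation-invariant state -/

variable {β : ℝ} (hβ : 0 ≤ β) (t t' : ℝ) {U : ℝ} (hU : 0 ≤ U) (μ hz : ℝ)
include hβ hU

/-- **Box entropies of a translation-invariant state against the pressure** (`β ≥ 0`, `U ≥ 0`, `ℓ ≥ 1`):
`S(ω_{[0,ℓ)²}) ≤ ℓ²·(P(β;t,t',U;μ,h) + β·u(ω)) + β(8|t|+16|t'|)ℓ + 2 log(ℓ²+1)`, `u(ω) = e_Φ(ω) − μρ(ω) − h m(ω)`.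
Gibbs' inequality for the restriction `ω_{B_ℓ}` and the free-boundary Hamiltonian `K_{B_ℓ}`, then the open-box pressure
bound. [cite: Israel1979, Lemma II.3.1] [cite: ArakiMoriya2003, Theorem 3.8 and §10] -/
theorem IsTranslationInvariant.vonNeumannEntropy_rdm_halfOpenBox_le (hω : ω.IsTranslationInvariant) {ℓ : ℕ} (hℓ : 1 ≤ ℓ) :
    vonNeumannEntropy (ω.rdm (halfOpenBox 2 ℓ)) ≤
      (ℓ : ℝ) ^ 2 * (gcPressureTT'Zeeman β t t' U μ hz +
          β * (ω.meanEnergy (hubbardTTPrimeFermionInteraction t t' U) 1 - μ * ω.density -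
            hz * ((ω.expect ({0} : Finset (Site 2)) (nAt 0 (mem_singleton_self 0) 0)).re -
              (ω.expect ({0} : Finset (Site 2)) (nAt 0 (mem_singleton_self 0) 1)).re))) +
        β * ((8 * |t| + 16 * |t'|) * ℓ) + 2 * Real.log ((ℓ : ℝ) ^ 2 + 1) := by
  set B := halfOpenBox 2 ℓ with hB
  set K := gcLocalHamiltonianTT' B t t' U μ hz with hK
  have hGibbs := (gcLocalHamiltonianTT'_isHermitian B t t' U μ hz).vonNeumannEntropy_sub_mul_le_log_partitionFn β
    (ω.rdm_posSemidef B) (ω.trace_rdm B)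
  rw [trace_rdm_mul] at hGibbs
  have hZ := log_partitionFn_gcLocalHamiltonianTT'_halfOpenBox_le hβ t t' hU μ hz hℓ
  have hE := hω.re_expect_gcLocalHamiltonianTT'_halfOpenBox_le t t' U μ hz ℓ
  have hβE := mul_le_mul_of_nonneg_left hE hβ
  rw [← hB, ← hK] at hZ hE hβE
  nlinarith [hGibbs, hZ, hβE]

omit hβ hU in
/-- `log(ℓ²+1) ≤ 2ℓ` for `ℓ ≥ 1` (`log(ℓ²+1) ≤ 2 log(ℓ+1) ≤ 2ℓ`; crude but enough for the `o(ℓ²)`). [folklore] -/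
private theorem log_sq_add_one_le (ℓ : ℕ) (hℓ : 1 ≤ ℓ) : Real.log ((ℓ : ℝ) ^ 2 + 1) ≤ 2 * ℓ := by
  have hℓ' : (1 : ℝ) ≤ ℓ := by exact_mod_cast hℓ
  have h1 : (ℓ : ℝ) ^ 2 + 1 ≤ ((ℓ : ℝ) + 1) ^ 2 := by nlinarith
  have h2 : Real.log ((ℓ : ℝ) ^ 2 + 1) ≤ Real.log (((ℓ : ℝ) + 1) ^ 2) := Real.log_le_log (by positivity) h1
  have h3 : Real.log (((ℓ : ℝ) + 1) ^ 2) = 2 * Real.log ((ℓ : ℝ) + 1) := by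
    rw [Real.log_pow]; push_cast; ring
  have h4 : Real.log ((ℓ : ℝ) + 1) ≤ (ℓ : ℝ) + 1 - 1 := Real.log_le_sub_one_of_pos (by positivity)
  linarith

/-- **Per-site form with an explicit rate**: for every translation-invariant `ω` and `ℓ ≥ 1`,
`S(ω_{[0,ℓ)²})/ℓ² ≤ P + β·u(ω) + (β(8|t|+16|t'|) + 4)/ℓ`. [cite: Israel1979, Lemma II.3.1] -/
theorem IsTranslationInvariant.vonNeumannEntropy_rdm_halfOpenBox_div_sq_le (hω : ω.IsTranslationInvariant) {ℓ : ℕ}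
    (hℓ : 1 ≤ ℓ) :
    vonNeumannEntropy (ω.rdm (halfOpenBox 2 ℓ)) / (ℓ : ℝ) ^ 2 ≤
      gcPressureTT'Zeeman β t t' U μ hz +
          β * (ω.meanEnergy (hubbardTTPrimeFermionInteraction t t' U) 1 - μ * ω.density -
            hz * ((ω.expect ({0} : Finset (Site 2)) (nAt 0 (mem_singleton_self 0) 0)).re -
              (ω.expect ({0} : Finset (Site 2)) (nAt 0 (mem_singleton_self 0) 1)).re)) +
        (β * (8 * |t| + 16 * |t'|) + 4) / ℓ := by
  have h := hω.vonNeumannEntropy_rdm_halfOpenBox_le hβ t t' hU μ hz hℓ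
  have hlog := log_sq_add_one_le ℓ hℓ
  have hℓpos : (0 : ℝ) < ℓ := by exact_mod_cast hℓ
  have hℓ2 : (0 : ℝ) < (ℓ : ℝ) ^ 2 := by positivity
  rw [div_le_iff₀ hℓ2]
  have e1 : (β * (8 * |t| + 16 * |t'|) + 4) / ℓ * (ℓ : ℝ) ^ 2 = (β * (8 * |t| + 16 * |t'|) + 4) * ℓ := by
    field_simp
  nlinarith [h, hlog, e1, hβ]

/-- **The upper half of the variational principle, limit form**: for every translation-invariant `ω` and `ε > 0`,
eventually in `ℓ`: `S(ω_{[0,ℓ)²})/ℓ² ≤ P + β·u(ω) + ε` — no translation-invariant state has more entropy per site than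
`P + β·u`. [cite: ArakiMoriya2003, Theorem 3.8 and §10] -/
theorem IsTranslationInvariant.eventually_vonNeumannEntropy_rdm_div_sq_le (hω : ω.IsTranslationInvariant)
    {ε : ℝ} (hε : 0 < ε) :
    ∀ᶠ ℓ : ℕ in atTop, vonNeumannEntropy (ω.rdm (halfOpenBox 2 ℓ)) / (ℓ : ℝ) ^ 2 ≤
      gcPressureTT'Zeeman β t t' U μ hz +
          β * (ω.meanEnergy (hubbardTTPrimeFermionInteraction t t' U) 1 - μ * ω.density -
            hz * ((ω.expect ({0} : Finset (Site 2)) (nAt 0 (mem_singleton_self 0) 0)).re -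
              (ω.expect ({0} : Finset (Site 2)) (nAt 0 (mem_singleton_self 0) 1)).re)) + ε := by
  set c : ℝ := β * (8 * |t| + 16 * |t'|) + 4 with hc
  have hc0 : 0 ≤ c := by rw [hc]; positivity
  have hlim : Tendsto (fun ℓ : ℕ => c / (ℓ : ℝ)) atTop (𝓝 0) := tendsto_const_div_atTop_nhds_zero_nat c
  filter_upwards [(tendsto_order.1 hlim).2 ε hε, eventually_ge_atTop 1] with ℓ hℓε hℓ
  have h := hω.vonNeumannEntropy_rdm_halfOpenBox_div_sq_le hβ t t' hU μ hz hℓ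
  rw [← hc] at h
  linarith

/-! ### §4 Thermal grand-canonical states attain it: the entropy density is `P + βu` -/

variable {Ls : ℕ → ℕ}

/-- **Box entropies of a thermal grand-canonical state are at least `|B|(P + βu)`**, for EVERY box `[0,ℓ)²`, `ℓ ≥ 1`
(the entropy row of `…ThermalStatesEntropyRow` against the near-optimal witness of §1).
[cite: Israel1979, Lemma II.3.1] [cite: ArakiMoriya2003, Theorem 3.8 and §10] -/
theorem IsTorusLimitOfMixture.sq_mul_le_vonNeumannEntropy_rdm_halfOpenBox_of_gcGibbs
    (hω : ω.IsTorusLimitOfMixture sourcedGibbsCount (gcGibbsWeightTT' β t t' U μ hz) (gcGibbsVectorTT' t t' U μ hz) Ls)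
    (hLs : Tendsto Ls atTop atTop) {ℓ : ℕ} (hℓ : 1 ≤ ℓ) :
    (ℓ : ℝ) ^ 2 * (gcPressureTT'Zeeman β t t' U μ hz +
        β * (ω.meanEnergy (hubbardTTPrimeFermionInteraction t t' U) 1 - μ * ω.density -
          hz * ((ω.expect ({0} : Finset (Site 2)) (nAt 0 (mem_singleton_self 0) 0)).re -
            (ω.expect ({0} : Finset (Site 2)) (nAt 0 (mem_singleton_self 0) 1)).re))) ≤
      vonNeumannEntropy (ω.rdm (halfOpenBox 2 ℓ)) := by
  have hm : ∀ i : Fin 2, 0 < (fun _ : Fin 2 => ℓ) i := fun _ => hℓ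
  have hprod : ∏ i : Fin 2, (((fun _ : Fin 2 => ℓ) i : ℕ) : ℝ) = (ℓ : ℝ) ^ 2 := by simp
  have hℓ2 : (0 : ℝ) < (ℓ : ℝ) ^ 2 := by positivity
  refine le_vonNeumannEntropy_of_forall_witness (ω.rdm_posSemidef _) (ω.trace_rdm _) fun G hG => ?_
  have h := hω.gcPressureTT'Zeeman_add_mul_energy_le_of_gcGibbs_box hβ t t' hU μ hz hLs hm hG
  rw [hprod, le_div_iff₀ hℓ2] at h
  rw [trace_rdm_mul]
  -- `halfOpenRect (fun _ => ℓ)` is `halfOpenBox 2 ℓ` by definition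
  calc (ℓ : ℝ) ^ 2 * _ = _ * (ℓ : ℝ) ^ 2 := mul_comm _ _
    _ ≤ (ω.expect (halfOpenRect fun _ : Fin 2 => ℓ) G).re + Real.log (partitionFn 1 G).re := h
    _ = (ω.expect (halfOpenBox 2 ℓ) G).re + Real.log (partitionFn 1 G).re := rfl

/-- **THE TWO-SIDED FINITE-BOX ENTROPY WINDOW OF A THERMAL GRAND-CANONICAL STATE** (`ℓ ≥ 1`):
`P + βu(ω) ≤ S(ω_{[0,ℓ)²})/ℓ² ≤ P + βu(ω) + (β(8|t|+16|t'|) + 4)/ℓ`. [cite: ArakiMoriya2003, Theorem 3.8 and §10] -/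
theorem IsTorusLimitOfMixture.vonNeumannEntropy_rdm_div_sq_mem_Icc_of_gcGibbs
    (hω : ω.IsTorusLimitOfMixture sourcedGibbsCount (gcGibbsWeightTT' β t t' U μ hz) (gcGibbsVectorTT' t t' U μ hz) Ls)
    (hLs : Tendsto Ls atTop atTop) {ℓ : ℕ} (hℓ : 1 ≤ ℓ) :
    vonNeumannEntropy (ω.rdm (halfOpenBox 2 ℓ)) / (ℓ : ℝ) ^ 2 ∈ Set.Icc
      (gcPressureTT'Zeeman β t t' U μ hz +
        β * (ω.meanEnergy (hubbardTTPrimeFermionInteraction t t' U) 1 - μ * ω.density -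
          hz * ((ω.expect ({0} : Finset (Site 2)) (nAt 0 (mem_singleton_self 0) 0)).re -
            (ω.expect ({0} : Finset (Site 2)) (nAt 0 (mem_singleton_self 0) 1)).re)))
      (gcPressureTT'Zeeman β t t' U μ hz +
        β * (ω.meanEnergy (hubbardTTPrimeFermionInteraction t t' U) 1 - μ * ω.density -
          hz * ((ω.expect ({0} : Finset (Site 2)) (nAt 0 (mem_singleton_self 0) 0)).re -
            (ω.expect ({0} : Finset (Site 2)) (nAt 0 (mem_singleton_self 0) 1)).re)) +
        (β * (8 * |t| + 16 * |t'|) + 4) / ℓ) := by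
  refine ⟨?_, (hω.isTranslationInvariant).vonNeumannEntropy_rdm_halfOpenBox_div_sq_le hβ t t' hU μ hz hℓ⟩
  have h := hω.sq_mul_le_vonNeumannEntropy_rdm_halfOpenBox_of_gcGibbs hβ t t' hU μ hz hLs hℓ
  have hℓ2 : (0 : ℝ) < (ℓ : ℝ) ^ 2 := by positivity
  rw [le_div_iff₀ hℓ2]
  linarith

/-- **THE ENTROPY DENSITY OF A THERMAL GRAND-CANONICAL STATE EXISTS AND EQUALS `P + β·u(ω)`**:
`S(ω_{[0,ℓ)²})/ℓ² → P(β;t,t',U;μ,h) + β(e_Φ(ω) − μρ(ω) − h m(ω))` as `ℓ → ∞`, for every torus limit `ω` of the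
grand-canonical Gibbs states (`β ≥ 0`, `U ≥ 0`). [cite: ArakiMoriya2003, Theorem 3.8 and §10]
[cite: BratteliRobinsonII1997, Thm. 6.2.40] -/
theorem IsTorusLimitOfMixture.tendsto_vonNeumannEntropy_rdm_div_sq_of_gcGibbs
    (hω : ω.IsTorusLimitOfMixture sourcedGibbsCount (gcGibbsWeightTT' β t t' U μ hz) (gcGibbsVectorTT' t t' U μ hz) Ls)
    (hLs : Tendsto Ls atTop atTop) :
    Tendsto (fun ℓ : ℕ => vonNeumannEntropy (ω.rdm (halfOpenBox 2 ℓ)) / (ℓ : ℝ) ^ 2) atTop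
      (𝓝 (gcPressureTT'Zeeman β t t' U μ hz +
        β * (ω.meanEnergy (hubbardTTPrimeFermionInteraction t t' U) 1 - μ * ω.density -
          hz * ((ω.expect ({0} : Finset (Site 2)) (nAt 0 (mem_singleton_self 0) 0)).re -
            (ω.expect ({0} : Finset (Site 2)) (nAt 0 (mem_singleton_self 0) 1)).re)))) := by
  set s : ℝ := gcPressureTT'Zeeman β t t' U μ hz +
    β * (ω.meanEnergy (hubbardTTPrimeFermionInteraction t t' U) 1 - μ * ω.density -
      hz * ((ω.expect ({0} : Finset (Site 2)) (nAt 0 (mem_singleton_self 0) 0)).re -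
        (ω.expect ({0} : Finset (Site 2)) (nAt 0 (mem_singleton_self 0) 1)).re)) with hs
  set c : ℝ := β * (8 * |t| + 16 * |t'|) + 4 with hc
  have hupper : Tendsto (fun ℓ : ℕ => s + c / (ℓ : ℝ)) atTop (𝓝 s) := by
    have h := (tendsto_const_div_atTop_nhds_zero_nat c).const_add s
    rwa [add_zero] at h
  refine tendsto_of_tendsto_of_tendsto_of_le_of_le' tendsto_const_nhds hupper ?_ ?_
  · filter_upwards [eventually_ge_atTop 1] with ℓ hℓ
    exact (hω.vonNeumannEntropy_rdm_div_sq_mem_Icc_of_gcGibbs hβ t t' hU μ hz hLs hℓ).1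
  · filter_upwards [eventually_ge_atTop 1] with ℓ hℓ
    exact (hω.vonNeumannEntropy_rdm_div_sq_mem_Icc_of_gcGibbs hβ t t' hU μ hz hLs hℓ).2

/-- **GIBBS' VARIATIONAL PRINCIPLE (thermodynamic limit): thermal grand-canonical states maximise «entropy minus
`β`·energy» per site among translation-invariant states.** For a thermal grand-canonical state `ω` and any
translation-invariant `ω'`, for every `ε > 0`, eventually in `ℓ`:
`S(ω'_{[0,ℓ)²})/ℓ² − β·u(ω') ≤ S(ω_{[0,ℓ)²})/ℓ² − β·u(ω) + ε` (and the right-hand side tends to the pressure `P`).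
[cite: ArakiMoriya2003, Theorem 3.8 and §10] [cite: Israel1979, Lemma II.3.1] -/
theorem IsTorusLimitOfMixture.variational_principle_of_gcGibbs
    (hω : ω.IsTorusLimitOfMixture sourcedGibbsCount (gcGibbsWeightTT' β t t' U μ hz) (gcGibbsVectorTT' t t' U μ hz) Ls)
    (hLs : Tendsto Ls atTop atTop) {ω' : InfVolFermionState 2} (hω' : ω'.IsTranslationInvariant) {ε : ℝ} (hε : 0 < ε) :
    ∀ᶠ ℓ : ℕ in atTop,
      vonNeumannEntropy (ω'.rdm (halfOpenBox 2 ℓ)) / (ℓ : ℝ) ^ 2 -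
          β * (ω'.meanEnergy (hubbardTTPrimeFermionInteraction t t' U) 1 - μ * ω'.density -
            hz * ((ω'.expect ({0} : Finset (Site 2)) (nAt 0 (mem_singleton_self 0) 0)).re -
              (ω'.expect ({0} : Finset (Site 2)) (nAt 0 (mem_singleton_self 0) 1)).re)) ≤
        vonNeumannEntropy (ω.rdm (halfOpenBox 2 ℓ)) / (ℓ : ℝ) ^ 2 -
          β * (ω.meanEnergy (hubbardTTPrimeFermionInteraction t t' U) 1 - μ * ω.density -
            hz * ((ω.expect ({0} : Finset (Site 2)) (nAt 0 (mem_singleton_self 0) 0)).re -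
              (ω.expect ({0} : Finset (Site 2)) (nAt 0 (mem_singleton_self 0) 1)).re)) + ε := by
  filter_upwards [hω'.eventually_vonNeumannEntropy_rdm_div_sq_le hβ t t' hU μ hz hε, eventually_ge_atTop 1]
    with ℓ h' hℓ
  have h := (hω.vonNeumannEntropy_rdm_div_sq_mem_Icc_of_gcGibbs hβ t t' hU μ hz hLs hℓ).1
  linarith

/-- **Certified entropy-density windows.** For a thermal grand-canonical state `ω`, a pressure window `W ≤ P ≤ Q` and a
`K`-energy window `u₋ ≤ u(ω) ≤ u₊` give, for every `ℓ ≥ 1`,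
`W + βu₋ ≤ S(ω_{[0,ℓ)²})/ℓ² ≤ Q + βu₊ + (β(8|t|+16|t'|) + 4)/ℓ` — the ENTROPY PER SITE of a thermal state is a
certified number from three (R59/R67) certificates. [cite: ArakiMoriya2003, Theorem 3.8 and §10] -/
theorem IsTorusLimitOfMixture.vonNeumannEntropy_rdm_div_sq_mem_Icc_of_gcGibbs_of_windows
    (hω : ω.IsTorusLimitOfMixture sourcedGibbsCount (gcGibbsWeightTT' β t t' U μ hz) (gcGibbsVectorTT' t t' U μ hz) Ls)
    (hLs : Tendsto Ls atTop atTop) {ℓ : ℕ} (hℓ : 1 ≤ ℓ) {W Q ulo uhi : ℝ}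
    (hW : W ≤ gcPressureTT'Zeeman β t t' U μ hz) (hQ : gcPressureTT'Zeeman β t t' U μ hz ≤ Q)
    (hulo : ulo ≤ ω.meanEnergy (hubbardTTPrimeFermionInteraction t t' U) 1 - μ * ω.density -
      hz * ((ω.expect ({0} : Finset (Site 2)) (nAt 0 (mem_singleton_self 0) 0)).re -
        (ω.expect ({0} : Finset (Site 2)) (nAt 0 (mem_singleton_self 0) 1)).re))
    (huhi : ω.meanEnergy (hubbardTTPrimeFermionInteraction t t' U) 1 - μ * ω.density -
      hz * ((ω.expect ({0} : Finset (Site 2)) (nAt 0 (mem_singleton_self 0) 0)).re -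
        (ω.expect ({0} : Finset (Site 2)) (nAt 0 (mem_singleton_self 0) 1)).re) ≤ uhi) :
    vonNeumannEntropy (ω.rdm (halfOpenBox 2 ℓ)) / (ℓ : ℝ) ^ 2 ∈
      Set.Icc (W + β * ulo) (Q + β * uhi + (β * (8 * |t| + 16 * |t'|) + 4) / ℓ) := by
  obtain ⟨h1, h2⟩ := hω.vonNeumannEntropy_rdm_div_sq_mem_Icc_of_gcGibbs hβ t t' hU μ hz hLs hℓ
  have h3 := mul_le_mul_of_nonneg_left hulo hβ
  have h4 := mul_le_mul_of_nonneg_left huhi hβ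
  exact ⟨by linarith, by linarith⟩

end InfVolFermionState

end Literature.MathematicalPhysics.QuantumLattice

end
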